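import Summits.QuantumFields.GaugeBoot.HaarShiftPlaquetteSign
import HarnessLib

/-!
# The DLR plaquette sign rule for infinite-volume Gibbs measures and Class-B states
(gauge-boot, Class B; corollaries of `HaarShiftPlaquetteSign.lean`)

HONEST FRAMING (cell `pub-gaugeboot`, page 1 of every file): the venture produces certified bounds
on lattice expectations at stated coupling, gauge group, dimension and torus size; NOT a mass gap,
NOT a continuum limit, NOT a string tension; NOT Yang–Mills-summit-bearing (barriers
`FixedCouplingUltralocality`, `PerturbativeInvisibility`). Structural; certifies no number.

## Content

The sign rule of `HaarShiftPlaquetteSign.lean` in the tree's standard vocabularies: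

* ★★★ **`mul_sum_integral_plaquetteObs_pos_of_mem_ymGibbsMeasures`** — for EVERY infinite-volume
  DLR state `μ ∈ ymGibbsMeasures ρ β` (Georgii's `𝒢(β)`; `G` compact metrisable, `ρ` continuous
  without invariant vectors, `N ≥ 1`, `d ≥ 2`, `β ≠ 0`) and every link `e`:
  `0 < β · Σ_{p ∋ e} ∫ Re tr ρ(U_p) dμ` (every DLR state is a one-link Haar-shift state, tree
  `isHaarShiftState_of_mem_ymGibbsMeasures`); `…_neg_of_neg` / `…_pos_of_pos`; `…_suN`.
* ★★ **`ClassBState.mul_sum_integral_plaquetteObs_pos`** — the same for every Class-B state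
  (`β ≠ 0`; at `β < 0` there is none, `ClassBState.false_of_neg'`).

Elementary corollaries; no new ideas.
-/

open MeasureTheory

namespace Summit.QuantumFields.GaugeBoot

open Literature.MathematicalPhysics.QuantumFieldTheory (haarProbability)
open Literature.MathematicalPhysics.QuantumLattice
open Literature.Probability.LatticeModels (IsGibbsMeasure)

noncomputable section

variable {d N : ℕ} {G : Type*} [Group G] [TopologicalSpace G] [IsTopologicalGroup G]
  [CompactSpace G] [MeasurableSpace G] [BorelSpace G] [SecondCountableTopology G] [NeZero N]
  (ρ : G →* Matrix (Fin N) (Fin N) ℂ)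

/-- ★★★ **The DLR plaquette sign rule for Gibbs measures.** Every infinite-volume DLR state
`μ ∈ 𝒢(β)` of lattice `G`-gauge theory (`ρ` continuous without invariant vectors, `N ≥ 1`, `d ≥ 2`,
`β ≠ 0`) satisfies `0 < β · Σ_{p ∋ e} ∫ Re tr ρ(U_p) dμ` for every link `e`. -/
theorem mul_sum_integral_plaquetteObs_pos_of_mem_ymGibbsMeasures [T2Space G] (hρ : Continuous ρ)
    (hρ0 : ∀ m : G, ∫ g, ((ρ (g * m)).trace).re ∂(haarProbability G) = 0) (hd : 2 ≤ d) {β : ℝ}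
    (hβ : β ≠ 0) {μ : Measure (LGConfig d G)} (hμ : μ ∈ ymGibbsMeasures ρ β) (e : ZdEdge d) :
    0 < β * ∑ p ∈ plaquettesTouching ({e} : Finset (ZdEdge d)),
      ∫ U, plaquetteObs ρ p.1 p.2.1.1 p.2.1.2 U ∂μ := by
  have hG : IsGibbsMeasure (ymSpecification ρ β) μ := hμ
  haveI := hG.isProbabilityMeasure
  exact (isHaarShiftState_of_mem_ymGibbsMeasures ρ hρ hμ).mul_sum_integral_plaquetteObs_pos
    ρ hρ hρ0 hd hβ e

/-- `β < 0`: the plaquette sum around every link is negative in every DLR state. -/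
theorem sum_integral_plaquetteObs_neg_of_mem_ymGibbsMeasures [T2Space G] (hρ : Continuous ρ)
    (hρ0 : ∀ m : G, ∫ g, ((ρ (g * m)).trace).re ∂(haarProbability G) = 0) (hd : 2 ≤ d) {β : ℝ}
    (hβ : β < 0) {μ : Measure (LGConfig d G)} (hμ : μ ∈ ymGibbsMeasures ρ β) (e : ZdEdge d) :
    ∑ p ∈ plaquettesTouching ({e} : Finset (ZdEdge d)),
      ∫ U, plaquetteObs ρ p.1 p.2.1.1 p.2.1.2 U ∂μ < 0 := by
  have h := mul_sum_integral_plaquetteObs_pos_of_mem_ymGibbsMeasures ρ hρ hρ0 hd hβ.ne hμ e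
  by_contra hge
  push Not at hge
  nlinarith

/-- `β > 0`: the plaquette sum around every link is positive in every DLR state. -/
theorem sum_integral_plaquetteObs_pos_of_mem_ymGibbsMeasures [T2Space G] (hρ : Continuous ρ)
    (hρ0 : ∀ m : G, ∫ g, ((ρ (g * m)).trace).re ∂(haarProbability G) = 0) (hd : 2 ≤ d) {β : ℝ}
    (hβ : 0 < β) {μ : Measure (LGConfig d G)} (hμ : μ ∈ ymGibbsMeasures ρ β) (e : ZdEdge d) :
    0 < ∑ p ∈ plaquettesTouching ({e} : Finset (ZdEdge d)),
      ∫ U, plaquetteObs ρ p.1 p.2.1.1 p.2.1.2 U ∂μ :=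
  pos_of_mul_pos_right
    (mul_sum_integral_plaquetteObs_pos_of_mem_ymGibbsMeasures ρ hρ hρ0 hd hβ.ne' hμ e) hβ.le

/-- ★★ **Class-B states obey the sign rule** (`β ≠ 0`; combined with `u_P ≥ 0` from diagonal RP
this is the emptiness at `β < 0`). -/
theorem ClassBState.mul_sum_integral_plaquetteObs_pos (hρ : Continuous ρ)
    (hρ0 : ∀ m : G, ∫ g, ((ρ (g * m)).trace).re ∂(haarProbability G) = 0) (hd : 2 ≤ d) {β : ℝ}
    (hβ : β ≠ 0) (w : ClassBState d ρ β) (e : ZdEdge d) :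
    0 < β * ∑ p ∈ plaquettesTouching ({e} : Finset (ZdEdge d)),
      ∫ U, plaquetteObs ρ p.1 p.2.1.1 p.2.1.2 U ∂w.μ := by
  haveI := w.isProbabilityMeasure
  exact w.haarShift.mul_sum_integral_plaquetteObs_pos ρ hρ hρ0 hd hβ e

/-! ## `SU(N)` -/

/-- ★★★ **`SU(N)` lattice gauge theory (`N ≥ 2`, `d ≥ 2`): in every infinite-volume DLR state at
`β ≠ 0` the plaquette sum around every link has the strict sign of `β`.** -/
theorem mul_sum_integral_plaquetteObs_pos_of_mem_ymGibbsMeasures_suN {d N : ℕ} (hd : 2 ≤ d)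
    (hN : 2 ≤ N) {β : ℝ} (hβ : β ≠ 0)
    {μ : Measure (LGConfig d (Matrix.specialUnitaryGroup (Fin N) ℂ))}
    (hμ : μ ∈ ymGibbsMeasures (fundamentalRep (Fin N)) β) (e : ZdEdge d) :
    0 < β * ∑ p ∈ plaquettesTouching ({e} : Finset (ZdEdge d)),
      ∫ U, plaquetteObs (fundamentalRep (Fin N)) p.1 p.2.1.1 p.2.1.2 U ∂μ := by
  haveI : NeZero N := ⟨by omega⟩
  haveI : SecondCountableTopology (Matrix (Fin N) (Fin N) ℂ) :=
    inferInstanceAs (SecondCountableTopology (Fin N → Fin N → ℂ))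
  haveI : SecondCountableTopology (Matrix.specialUnitaryGroup (Fin N) ℂ) :=
    Topology.IsEmbedding.subtypeVal.secondCountableTopology
  obtain ⟨z, ζ, hζ1, hz, -⟩ :=
    Literature.MathematicalPhysics.QuantumFieldTheory.IsSpecialUnitaryModel.exists_central
      (fundamentalRep (Fin N))
      (Literature.MathematicalPhysics.QuantumFieldTheory.TorusAreaLaw.isSpecialUnitaryModel_fundamentalRep
        N) hN
  exact mul_sum_integral_plaquetteObs_pos_of_mem_ymGibbsMeasures (fundamentalRep (Fin N))
    (continuous_fundamentalRep (Fin N))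
    (integral_re_trace_mul_eq_zero_of_smul_one (fundamentalRep (Fin N))
      (continuous_fundamentalRep (Fin N)) hz hζ1) hd hβ hμ e

end

end Summit.QuantumFields.GaugeBoot
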